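import Summits.Ventures.Crystal3D.Theorems.StickyWulffConstantTextureLiminfTexShadowTerraceCensusThree
import HarnessLib

/-!
# The census of a Σ9 word off the twin-normal caps: `≥ 13/25` as soon as both twin planes are ≥ 11.54° from the wall
# (lane T, crux `TextureLiminfV5`, stmt-Ventures-23912, EDGE-ON residual; mechanism (β), cf-p1 RULING (ccxxv)(3); 19480-p1 g17 memo LAMELLA-CENSUS-g17 §3(iv))

HONEST FRAMING. Venture `Summits/Ventures/Crystal3D` (cell `crystal3d-full`), helper `--supports` the law-v5 crux `TextureLiminfV5` (stmt-Ventures-23912),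
lane T.  An ELEMENTARY inequality about `censusSum` (…TerraceCensusDefs p726089, …TerraceCensusThree p726475); no configuration, no certificate; F-C1 not moved.

THE POINT.  By …TerraceCensusThree every word of length `≥ 3` has census `≥ 4√2/9 > 13/25`; a length-2 (Σ9) word only has `≥ √2/3 ≈ 0.471`, the deficit
sitting on two small caps of wall normals around the two twin-plane normals (memo: the «Σ9 sliver», radius ≈ 4–10°).  This file makes the sliver's outside
explicit: writing `S_k = √(1 − ⟪v_k, e₃⟫²)` for the sines of the two plane normals `v₁ = B μ₁`, `v₂ = B (R_{μ₁} μ₂)` (`|⟪v₁,v₂⟫| = 1/3`), the spherical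
triangle inequality in algebraic form is `S₁² + S₂² + (2/3) S₁ S₂ ≥ 8/9` (`sineSum_quad_ge`), and with `S₁, S₂ ≥ 1/5` (both planes at least
`arcsin (1/5) ≈ 11.54°` from the wall plane's normal direction… i.e. `⟪v_k, e₃⟫² ≤ 24/25`) it forces `S₁ + S₂ ≥ 26/25`, i.e.
**`censusSum B (μ₁ :: μ₂ :: rest) ≥ 13/25`** (`censusSum_two_ge_of_far`).  So a `(13/25)`-capped table is census-dominated unless some facing bilayer-frame pair is
related by a Σ9 word one of whose two twin normals is within `11.54°` of `±e₃` — the Σ9 sliver, and nothing else, is what (β) leaves.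
WHAT THIS IS NOT: nothing about the sliver itself; F-C1 not moved.
-/

noncomputable section

open scoped BigOperators InnerProductSpace ENNReal
open MeasureTheory Filter

namespace Summit.Ventures.Crystal3D.Cruxes.TextureLiminf.TexShadow

open Summit.Ventures.Crystal3D Summit.Ventures.Crystal3D.Theorems
open Literature.MathematicalPhysics.StatisticalMechanics (IsHaggSeq fccStacking barlowStacking basalMirror)

/-- **The spherical triangle inequality `θ₁ + θ₂ ≥ ∠(v₁, v₂)` in algebraic form for `|cos ∠(v₁,v₂)| = 1/3`**: with `S_k = √(1 − ⟪v_k, e⟫²)`,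
`S₁² + S₂² + (2/3) S₁ S₂ ≥ 8/9`. -/
theorem sineSum_quad_ge {v₁ v₂ e : E3} (h₁ : ‖v₁‖ = 1) (h₂ : ‖v₂‖ = 1) (he : ‖e‖ = 1) (h12 : ⟪v₁, v₂⟫_ℝ ^ 2 = 1 / 9) :
    8 / 9 ≤ Real.sqrt (1 - ⟪v₁, e⟫_ℝ ^ 2) ^ 2 + Real.sqrt (1 - ⟪v₂, e⟫_ℝ ^ 2) ^ 2 +
      2 / 3 * (Real.sqrt (1 - ⟪v₁, e⟫_ℝ ^ 2) * Real.sqrt (1 - ⟪v₂, e⟫_ℝ ^ 2)) := by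
  set a := ⟪v₁, e⟫_ℝ with ha
  set b := ⟪v₂, e⟫_ℝ with hb
  set c := ⟪v₁, v₂⟫_ℝ with hc
  have ha1 : a ^ 2 ≤ 1 := by
    have h := abs_real_inner_le_norm v₁ e; rw [h₁, he, one_mul, ← ha] at h
    nlinarith [abs_nonneg a, sq_abs a]
  have hb1 : b ^ 2 ≤ 1 := by
    have h := abs_real_inner_le_norm v₂ e; rw [h₂, he, one_mul, ← hb] at h
    nlinarith [abs_nonneg b, sq_abs b]
  set A := Real.sqrt (1 - a ^ 2) with hA
  set B := Real.sqrt (1 - b ^ 2) with hB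
  have hA0 : 0 ≤ A := Real.sqrt_nonneg _
  have hB0 : 0 ≤ B := Real.sqrt_nonneg _
  have hA2 : A ^ 2 = 1 - a ^ 2 := Real.sq_sqrt (by linarith)
  have hB2 : B ^ 2 = 1 - b ^ 2 := Real.sq_sqrt (by linarith)
  -- Gram: `|c − ab| ≤ AB`; and `|c| = 1/3`
  have hG : (c - a * b) ^ 2 ≤ (A * B) ^ 2 := by
    rw [mul_pow, hA2, hB2]; exact sq_inner_sub_mul_le h₁ h₂ he
  have hP : |c - a * b| ≤ A * B := abs_le_of_sq_le_sq hG (mul_nonneg hA0 hB0)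
  have hc3 : |c| ≤ 1 / 3 := by
    rw [show (1 / 3 : ℝ) = Real.sqrt ((1 / 3) ^ 2) from (Real.sqrt_sq (by norm_num)).symm, ← Real.sqrt_sq_eq_abs]
    exact Real.sqrt_le_sqrt (by rw [h12]; norm_num)
  -- `|ab| ≤ |c| + |c − ab| ≤ 1/3 + AB`, squared: `a²b² ≤ (1/3 + AB)²`
  have hab : |a * b| ≤ 1 / 3 + A * B := by
    have h := abs_sub_abs_le_abs_sub (a * b) c
    rw [abs_sub_comm] at h
    linarith
  have hab2 : (a * b) ^ 2 ≤ (1 / 3 + A * B) ^ 2 := by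
    rw [← sq_abs (a * b)]
    exact pow_le_pow_left₀ (abs_nonneg _) hab 2
  -- expand with `a² = 1 − A²`, `b² = 1 − B²`
  nlinarith [hab2, hA2, hB2, mul_nonneg hA0 hB0]

/-- **Off the caps the two sines sum to ≥ 26/25**: `S₁, S₂ ≥ 1/5` and `S₁² + S₂² + (2/3)S₁S₂ ≥ 8/9` give `S₁ + S₂ ≥ 26/25`. -/
theorem sineSum_ge_of_quad_of_fifth {S₁ S₂ : ℝ} (hq : 8 / 9 ≤ S₁ ^ 2 + S₂ ^ 2 + 2 / 3 * (S₁ * S₂))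
    (hs₁ : 1 / 5 ≤ S₁) (hs₂ : 1 / 5 ≤ S₂) : 26 / 25 ≤ S₁ + S₂ := by
  by_contra hlt
  push Not at hlt
  have hprod : 0 ≤ (S₁ - 1 / 5) * (S₂ - 1 / 5) := mul_nonneg (by linarith) (by linarith)
  have ht0 : 0 ≤ S₁ + S₂ := by linarith
  nlinarith [hprod, mul_nonneg ht0 (by linarith : (0 : ℝ) ≤ 26 / 25 - (S₁ + S₂))]

/-- **The census of a length-≥-2 word whose first two twin normals are both at least `arcsin (1/5)` from the wall normal is `≥ 13/25`**:
`⟪B μ₁, e₃⟫² ≤ 24/25` and `⟪B (R_{μ₁} μ₂), e₃⟫² ≤ 24/25` suffice (the Σ9 census fails only on the two caps of radius `≈ 11.5°`). -/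
theorem censusSum_two_ge_of_far (B : E3 ≃ₗᵢ[ℝ] E3) {μ₁ μ₂ : E3}
    (h₁ : ‖μ₁‖ = 1 ∧ ∀ w ∈ fccSlots, ⟪w, μ₁⟫_ℝ = 0 ∨ ⟪w, μ₁⟫_ℝ = Real.sqrt (2 / 3) ∨ ⟪w, μ₁⟫_ℝ = -Real.sqrt (2 / 3))
    (h₂ : ‖μ₂‖ = 1) (h12 : ⟪μ₁, μ₂⟫_ℝ = 1 / 3 ∨ ⟪μ₁, μ₂⟫_ℝ = -1 / 3)
    (hfar₁ : ⟪B μ₁, e₃⟫_ℝ ^ 2 ≤ 24 / 25) (hfar₂ : ⟪B ((ℝ ∙ μ₁)ᗮ.reflection μ₂), e₃⟫_ℝ ^ 2 ≤ 24 / 25) (rest : List E3) :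
    13 / 25 ≤ censusSum B (μ₁ :: μ₂ :: rest) := by
  rw [censusSum_cons, censusSum_cons]
  simp only [LinearIsometryEquiv.trans_apply]
  set v₁ : E3 := B μ₁ with hv₁
  set v₂ : E3 := B ((ℝ ∙ μ₁)ᗮ.reflection μ₂) with hv₂
  have hn₁ : ‖v₁‖ = 1 := by rw [hv₁, LinearIsometryEquiv.norm_map, h₁.1]
  have hn₂ : ‖v₂‖ = 1 := by rw [hv₂, LinearIsometryEquiv.norm_map, LinearIsometryEquiv.norm_map, h₂]
  have hμ₁₁ : ⟪μ₁, μ₁⟫_ℝ = 1 := by rw [real_inner_self_eq_norm_sq, h₁.1, one_pow]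
  have h12' : ⟪v₁, v₂⟫_ℝ ^ 2 = 1 / 9 := by
    rw [hv₁, hv₂, LinearIsometryEquiv.inner_map_map, inner_reflection_unit h₁.1, real_inner_comm μ₁ μ₂, hμ₁₁]
    rcases h12 with h | h <;> rw [h] <;> norm_num
  have hq := sineSum_quad_ge hn₁ hn₂ norm_e₃_eq_one h12'
  set S₁ := Real.sqrt (1 - ⟪v₁, e₃⟫_ℝ ^ 2) with hS₁
  set S₂ := Real.sqrt (1 - ⟪v₂, e₃⟫_ℝ ^ 2) with hS₂
  -- `S_k ≥ 1/5` from the cap hypotheses, `S_k ≤ 1`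
  have hs₁ : 1 / 5 ≤ S₁ := by
    rw [hS₁, show (1 / 5 : ℝ) = Real.sqrt ((1 / 5) ^ 2) from (Real.sqrt_sq (by norm_num)).symm]
    exact Real.sqrt_le_sqrt (by linarith)
  have hs₂ : 1 / 5 ≤ S₂ := by
    rw [hS₂, show (1 / 5 : ℝ) = Real.sqrt ((1 / 5) ^ 2) from (Real.sqrt_sq (by norm_num)).symm]
    exact Real.sqrt_le_sqrt (by linarith)
  have hsum := sineSum_ge_of_quad_of_fifth hq hs₁ hs₂
  have hrest := censusSum_nonneg (((ℝ ∙ μ₂)ᗮ.reflection).trans (((ℝ ∙ μ₁)ᗮ.reflection).trans B)) rest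
  linarith

end Summit.Ventures.Crystal3D.Cruxes.TextureLiminf.TexShadow

end
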